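import Literature.NumberTheory.EllipticCurves.Kato2004.IwasawaH1ReductionPk
import Literature.NumberTheory.EllipticCurves.GaloisActionProofs
import Mathlib.CategoryTheory.CofilteredSystem
import Mathlib.CategoryTheory.Functor.OfSequence
import HarnessLib

/-!
# Kato 2004 (Astérisque 295) §8.2 / Rubin, *Euler Systems*, App. B Prop. B.2.3 (injectivity half):
# `H¹(U, T_pW)` is SEPARATED for the reductions modulo `p^k` — a class whose images in
# `H¹(U, W[p^k])` vanish for every `k` is zero; equivalently `⋂_k p^k · H¹(U, T_pW) = 0`

Topic `NumberTheory/EllipticCurves`, sub-directory `Kato2004` (namespace = path).  Cell `bsd-cn100`,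
prover seat `bsd-cn100-transfer-2` (g6).  THEOREMS ONLY (no definition, no named fact, no `sorry`,
no instance, no notation).  Brick (L1) of the discharge of the READING-grade named fact
`Kato2004.locP_kernel_isTorsion_of_rankOne` (`Kato2004/LocPKernelRankOne.lean`, conjunct 11 of the
citation-borne stub `stub_refereedInputs` of the registered lines `kato-zeta-perrin-riou` on
stmt-BirchSwinnertonDyer-19080 / -19160), coordinated on the cell bus with seat `bsd-cn100-s2-c3` (g9),
who holds the Selmer-side assembly: the assembly produces, from the finiteness of the `p`-strict
Selmer group in rank one (`finite_strictSelmer_of_mordellWeilRank_eq_one`, tree), an exponent `e`,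
UNIFORM in `k`, with `red_{p^k} (p^e • x) = 0` in `H¹(ℚ, W[p^k])` for every `k`; THIS file turns that
into `p^e • x = 0` in `H¹(ℚ, T_pW)`.  Nothing about BSD is claimed.

## What (for `W/ℚ` elliptic, `p` prime, any subgroup `U ≤ Γ_ℚ`, `red_{p^k} = Kato2004.reduceH1Pk W p k U`)

* §1 **`eq_zero_of_forall_reduceH1Pk_eq_zero`** — if `red_{p^k} x = 0` in `H¹(U, W[p^k])` for EVERY
  `k`, then `x = 0` in `H¹(U, T_pW)`.  PROOF, on continuous cochains (the tree's `H1` is Mathlib's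
  `continuousCohomology 1`; classes are classes of continuous crossed homomorphisms,
  `oneCocycleClass_surjective` / `oneCocycleClass_eq_zero_iff`): write `x = [φ]`; `red_{p^k}[φ] = 0`
  says that the WITNESS SET `X_k = {v ∈ W[p^k] | ∀ g, (φ g)_k = g v − v}` is non-empty; it is finite
  (`W[p^k]` is finite, AEC III.6.4 = `finite_torsionPoints_holds`), and `v ↦ p • v` maps `X_{k+1}` to
  `X_k` (the components of `T_pW = lim← W[p^k]` satisfy `p • a_{k+1} = a_k`, `TateModule.smul_proj_succ`,
  and the Galois action commutes with `p •`).  By Kőnig's lemma (Mathlib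
  `nonempty_sections_of_finite_inverse_system`, as in bsd-smallim's `exists_normCompatible_roots`) the
  inverse system `(X_k)` has a section `(v_k)`, i.e. an element `m = (v_k)_k ∈ T_pW` with
  `φ g = g m − m` for all `g` — so `[φ] = 0`.
* §2 corollaries: **`eq_of_forall_reduceH1Pk_eq`** (two classes with the same reductions at every
  level are equal: `H¹(U, T_pW) ↪ ∏_k H¹(U, W[p^k])`), **`eq_zero_of_forall_mem_pow_smul`**
  (`⋂_k p^k · H¹(U, T_pW) = 0`, since `red_{p^k}` kills `p^k`-multiples, `reduceH1Pk_pow_smul`), and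
  **`pow_smul_eq_zero_of_forall_reduceH1Pk_pow_smul_eq_zero`** (the assembly shape: a uniform exponent
  `e` with `red_{p^k}(p^e • x) = 0` for all `k` gives `p^e • x = 0`).

What is NOT here: the surjectivity half of Rubin B.2.3 / Tate (`H¹(U, T_pW) ↠ lim← H¹(U, W[p^k])`,
Mittag-Leffler), not needed by the consumer.

## The printed statements

* K. Kato, Astérisque 295 (2004) **§8.2 [p. 180]**: "`H^q(R, T) = lim←_n H^q(R, T/p^n)`" for a finitely
  generated `ℤ_p`-module `T` with continuous action (continuous-cochain cohomology).
* K. Rubin, *Euler Systems* (2000) **App. B, Prop. B.2.3**: for `T = lim← T/p^n` with each `T/p^n`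
  finite, `H¹(G, T) = lim← H¹(G, T/p^n)`.

References: K. Kato, Astérisque 295 (2004) §8.2 [Kato2004Asterisque]; K. Rubin, *Euler Systems* (2000)
App. B §2, Prop. B.2.3 [Rubin2000]; J.-P. Serre, *Galois Cohomology* (1997) I §2.2 (cochains,
`H¹ = Z¹/B¹`) [SerreGaloisCohomology1997]; J. H. Silverman, *AEC* (2009) III.6.4, III §7
[SilvermanAEC2009]; D. Kőnig's lemma (Mathlib `nonempty_sections_of_finite_inverse_system`); tree:
`Kato2004/IwasawaH1ReductionPk.lean` (`tateModPk`, `reduceH1Pk`, `reduceH1Pk_oneCocycleClass`,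
`reduceH1Pk_pow_smul`), `Kato2004/IwasawaH1ReductionKernel.lean` and `…Roots.lean` (the cochain style and
the Kőnig pattern, cell bsd-smallim), `TateModule.lean` (`TateModule.mk/proj/ext/smul_proj_succ`).
-/

noncomputable section

open scoped NumberField
open Field CategoryTheory
open Literature.NumberTheory.GaloisRepresentations
open Literature.NumberTheory.EllipticCurves Literature.NumberTheory.EllipticCurves.Kato2004
open Literature.NumberTheory.EllipticCurves.Kato2004.EulerSystemValues
open WeierstrassCurve (geomPoints geomTorsion)

namespace Literature.NumberTheory.EllipticCurves.Kato2004

variable (W : WeierstrassCurve ℚ) [W.IsElliptic] (p : ℕ) [Fact p.Prime]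
  [ContinuousSMul ℤ_[p] (W.tateModule p)]

/-! ## §1 Separatedness: a class with all reductions zero is zero -/

/-- **`H¹(U, T_pW)` is separated for the reductions modulo `p^k`** (Kato §8.2 / Rubin App. B
Prop. B.2.3, injectivity half).  For every subgroup `U ≤ Γ_ℚ` and every `x ∈ H¹(U, T_pW)`: if
`red_{p^k} x = 0` in `H¹(U, W[p^k])` for every `k` (`Kato2004.reduceH1Pk`), then `x = 0`.  Proof on
continuous cochains: the witness sets `{v ∈ W[p^k] | ∀ g, (φ g)_k = g v − v}` are finite and non-empty
and form an inverse system under `v ↦ p • v`; a section (Kőnig) is an `m ∈ T_pW` with `φ = ∂m`.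
[cite: Kato2004Asterisque, §8.2 (p. 180)] [cite: Rubin2000, App. B Prop. B.2.3]
[cite: SilvermanAEC2009, Cor. III.6.4] -/
theorem eq_zero_of_forall_reduceH1Pk_eq_zero (U : Subgroup (absoluteGaloisGroup ℚ))
    (x : H1 (tateRep W p) U) (hx : ∀ k : ℕ, reduceH1Pk W p k U x = 0) : x = 0 := by
  classical
  have hp : p.Prime := Fact.out
  obtain ⟨φ, rfl⟩ := oneCocycleClass_surjective _ x
  -- the actions of `U` on `T_pW|_U` and on `W[p^k]|_U` are the Galois actions
  have hρ : ∀ (g : U) (a : W.tateModule p),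
      (subgroupRep (tateRep W p).toTopRep U).ρ g a = (g : absoluteGaloisGroup ℚ) • a :=
    fun g a => rfl
  have hρk : ∀ (k : ℕ) (g : U) (v : geomTorsion W ((p : ℤ) ^ k)),
      (subgroupRep (W.torsionGaloisModule ((p : ℤ) ^ k)).toTopRep U).ρ g v =
        (g : absoluteGaloisGroup ℚ) • v :=
    fun k g v => rfl
  -- for each `k`, a coboundary witness `v_k ∈ W[p^k]` of `φ mod p^k`
  have hk : ∀ k : ℕ, ∃ v : geomTorsion W ((p : ℤ) ^ k), ∀ g : U,
      TateModule.proj p k (φ.1 g) =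
        (g : absoluteGaloisGroup ℚ) • (v : geomPoints W) - (v : geomPoints W) := by
    intro k
    have h := hx k
    rw [reduceH1Pk_oneCocycleClass, oneCocycleClass_eq_zero_iff] at h
    obtain ⟨v, hv⟩ := h
    refine ⟨v, fun g => ?_⟩
    have h1 := congrArg (fun P : geomTorsion W ((p : ℤ) ^ k) => (P : geomPoints W)) (hv g)
    simp only [AddSubgroupClass.coe_sub, hρk, AddSubgroup.torsionBy.coe_smul] at h1
    exact h1
  -- the witness sets `X_k` and the transition maps `v ↦ p • v`
  let X : ℕ → Type := fun k => {v : geomTorsion W ((p : ℤ) ^ k) //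
    ∀ g : U, TateModule.proj p k (φ.1 g) =
      (g : absoluteGaloisGroup ℚ) • (v : geomPoints W) - (v : geomPoints W)}
  have hmem : ∀ (k : ℕ) (v : geomTorsion W ((p : ℤ) ^ (k + 1))),
      p • (v : geomPoints W) ∈ geomTorsion W ((p : ℤ) ^ k) := by
    intro k v
    have hv : ((p : ℤ) ^ (k + 1)) • (v : geomPoints W) = 0 := (Submodule.mem_torsionBy_iff _ _).mp v.2
    refine (Submodule.mem_torsionBy_iff _ _).mpr ?_
    rw [← natCast_zsmul, smul_smul, ← pow_succ, hv]
  have htrans : ∀ (k : ℕ) (v : X (k + 1)) (g : U),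
      TateModule.proj p k (φ.1 g) =
        (g : absoluteGaloisGroup ℚ) • (p • ((v.1 : geomTorsion W _) : geomPoints W)) -
          p • ((v.1 : geomTorsion W _) : geomPoints W) := by
    intro k v g
    rw [← TateModule.smul_proj_succ k (φ.1 g), v.2 g, smul_sub, smul_comm]
  let f₀ : ∀ k, X (k + 1) → X k := fun k v =>
    ⟨⟨p • ((v.1 : geomTorsion W _) : geomPoints W), hmem k v.1⟩, fun g => htrans k v g⟩
  let f : ∀ k, X (k + 1) ⟶ X k := fun k => TypeCat.ofHom (f₀ k)
  let F : ℕᵒᵖ ⥤ Type := Functor.ofOpSequence (X := X) f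
  haveI : ∀ j : ℕᵒᵖ, Finite (F.obj j) := fun j => by
    change Finite (X j.unop)
    haveI : Finite (geomTorsion W ((p : ℤ) ^ j.unop)) :=
      W.finite_torsionPoints_holds (AlgebraicClosure ℚ)
        (pow_ne_zero _ (Int.natCast_ne_zero.mpr hp.ne_zero))
    exact Subtype.finite
  haveI : ∀ j : ℕᵒᵖ, Nonempty (F.obj j) := fun j => by
    change Nonempty (X j.unop)
    obtain ⟨v, hv⟩ := hk j.unop
    exact ⟨⟨v, hv⟩⟩
  -- Kőnig: a compatible family of witnesses
  obtain ⟨s, hs⟩ := nonempty_sections_of_finite_inverse_system F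
  have hsucc : ∀ k : ℕ,
      p • (((s (Opposite.op (k + 1)) : X (k + 1)).1 : geomTorsion W _) : geomPoints W) =
        (((s (Opposite.op k) : X k).1 : geomTorsion W _) : geomPoints W) := by
    intro k
    have h := hs (homOfLE (Nat.le_add_right k 1)).op
    rw [Functor.ofOpSequence_map_homOfLE_succ] at h
    exact congrArg (fun v : X k => ((v.1 : geomTorsion W _) : geomPoints W)) h
  have hpow : ∀ k : ℕ,
      p ^ k • (((s (Opposite.op k) : X k).1 : geomTorsion W _) : geomPoints W) = 0 := by
    intro k
    have hv : ((p : ℤ) ^ k) • (((s (Opposite.op k) : X k).1 : geomTorsion W _) : geomPoints W) = 0 :=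
      (Submodule.mem_torsionBy_iff _ _).mp ((s (Opposite.op k) : X k).1).2
    rw [← natCast_zsmul]
    push_cast
    exact hv
  -- the element `m = (v_k)_k ∈ T_pW` with `φ = ∂m`
  let m : W.tateModule p :=
    TateModule.mk (fun k => (((s (Opposite.op k) : X k).1 : geomTorsion W _) : geomPoints W))
      hpow hsucc
  rw [oneCocycleClass_eq_zero_iff]
  refine ⟨m, fun g => TateModule.ext fun k => ?_⟩
  rw [map_sub, hρ, TateModule.proj_smul_of_distribMulAction]
  simp only [m, TateModule.proj_mk]
  exact (s (Opposite.op k)).2 g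

/-! ## §2 Corollaries: injectivity into the product of the levels, `⋂_k p^k · H¹ = 0` -/

/-- **`H¹(U, T_pW) ↪ ∏_k H¹(U, W[p^k])`**: two classes with the same reduction modulo every `p^k` are
equal. [cite: Rubin2000, App. B Prop. B.2.3] [cite: Kato2004Asterisque, §8.2 (p. 180)] -/
theorem eq_of_forall_reduceH1Pk_eq (U : Subgroup (absoluteGaloisGroup ℚ))
    {x y : H1 (tateRep W p) U} (h : ∀ k : ℕ, reduceH1Pk W p k U x = reduceH1Pk W p k U y) :
    x = y := by
  rw [← sub_eq_zero]
  exact eq_zero_of_forall_reduceH1Pk_eq_zero W p U (x - y) fun k => by rw [map_sub, h k, sub_self]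

/-- **`⋂_k p^k · H¹(U, T_pW) = 0`**: a class divisible by every power of `p` is zero (the reduction
modulo `p^k` kills `p^k`-multiples, `reduceH1Pk_pow_smul`, and §1).
[cite: Kato2004Asterisque, §8.2 (p. 180) and §13.8 (p. 228)] [cite: Rubin2000, App. B Prop. B.2.3] -/
theorem eq_zero_of_forall_mem_pow_smul (U : Subgroup (absoluteGaloisGroup ℚ))
    (x : H1 (tateRep W p) U)
    (hx : ∀ k : ℕ, ∃ y : H1 (tateRep W p) U, ((p : ℤ_[p]) ^ k) • y = x) : x = 0 :=
  eq_zero_of_forall_reduceH1Pk_eq_zero W p U x fun k => by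
    obtain ⟨y, rfl⟩ := hx k
    exact reduceH1Pk_pow_smul W p k U y

/-- **The assembly shape**: a UNIFORM exponent `e` with `red_{p^k} (p^e • x) = 0` in `H¹(U, W[p^k])`
for every `k` forces `p^e • x = 0` in `H¹(U, T_pW)` — so `x` is `ℤ_p`-torsion.  (This is how a
levelwise bound, e.g. from a finite `p`-strict Selmer group, is lifted to `T_pW`-coefficients.)
[cite: Rubin2000, App. B Prop. B.2.3] [cite: Kato2004Asterisque, §8.2 (p. 180)] -/
theorem pow_smul_eq_zero_of_forall_reduceH1Pk_pow_smul_eq_zero (U : Subgroup (absoluteGaloisGroup ℚ))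
    (x : H1 (tateRep W p) U) (e : ℕ)
    (hx : ∀ k : ℕ, reduceH1Pk W p k U (((p : ℤ_[p]) ^ e) • x) = 0) :
    ((p : ℤ_[p]) ^ e) • x = 0 :=
  eq_zero_of_forall_reduceH1Pk_eq_zero W p U _ hx

/-! ## §3 The conclusion shape of `locP_kernel_isTorsion_of_rankOne`: `p`-power torsion from an
integer annihilator of the reductions -/

omit [Fact p.Prime] in
/-- **`p`-power extraction in a `ℤ_p`-module**: if `n • x = 0` with `n ≠ 0` then `p^j • x = 0` for
`j = v_p(n)` — the prime-to-`p` part of `n` is a unit of `ℤ_p` (`PadicInt.isUnit_iff`,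
`PadicInt.norm_int_lt_one_iff_dvd`).  Private helper. [folklore] -/
private theorem exists_pow_smul_eq_zero_of_nsmul_eq_zero [hp : Fact p.Prime] {M : Type*} [AddCommGroup M]
    [Module ℤ_[p] M] {n : ℕ} (hn : n ≠ 0) {x : M} (hx : n • x = 0) :
    ∃ j : ℕ, ((p : ℤ_[p]) ^ j) • x = 0 := by
  obtain ⟨a, m, hm, rfl⟩ := Nat.exists_eq_pow_mul_and_not_dvd hn p hp.out.ne_one
  refine ⟨a, ?_⟩
  -- the prime-to-`p` factor `m` is a unit of `ℤ_p`
  have hu : IsUnit ((m : ℤ_[p])) := by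
    rw [PadicInt.isUnit_iff]
    have h1 : ‖(m : ℤ_[p])‖ ≤ 1 := PadicInt.norm_le_one _
    have h2 : ¬ ‖(m : ℤ_[p])‖ < 1 := by
      rw [← Int.cast_natCast, PadicInt.norm_int_lt_one_iff_dvd]
      exact_mod_cast hm
    exact le_antisymm h1 (not_lt.mp h2)
  -- `m • (p^a • x) = n • x = 0`, cancel the unit
  have h0 : (m : ℤ_[p]) • (((p : ℤ_[p]) ^ a) • x) = 0 := by
    rw [← mul_smul, mul_comm, ← Nat.cast_pow, ← Nat.cast_mul, Nat.cast_smul_eq_nsmul, hx]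
  exact (hu.smul_left_cancel).mp (by rw [h0, smul_zero])

/-- **The conclusion shape of the named fact**: if for some integer `e ≠ 0` the reductions
`red_{p^k} (e • x)` vanish in `H¹(U, W[p^k])` for EVERY `k`, then `x` is `ℤ_p`-torsion:
`p^j • x = 0` for some `j` (§1 gives `e • x = 0`, then `p`-power extraction).  This is the form in
which a UNIFORM-in-`k` integer annihilator (e.g. from a finite `p`-strict Selmer group and bounded
local defects) yields the conclusion `∃ j, (p : ℤ_[p]) ^ j • x = 0` of
`Kato2004.locP_kernel_isTorsion_of_rankOne`. [cite: Rubin2000, App. B Prop. B.2.3]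
[cite: Kato2004Asterisque, §8.2 (p. 180)] -/
theorem exists_pow_smul_eq_zero_of_forall_reduceH1Pk_nsmul_eq_zero (U : Subgroup (absoluteGaloisGroup ℚ))
    (x : H1 (tateRep W p) U) {e : ℕ} (he : e ≠ 0)
    (hx : ∀ k : ℕ, reduceH1Pk W p k U (e • x) = 0) :
    ∃ j : ℕ, ((p : ℤ_[p]) ^ j) • x = 0 :=
  exists_pow_smul_eq_zero_of_nsmul_eq_zero p he (eq_zero_of_forall_reduceH1Pk_eq_zero W p U _ hx)

end Literature.NumberTheory.EllipticCurves.Kato2004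

end
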